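import Mathlib.CategoryTheory.ObjectProperty.Equivalence
import Literature.AnabelianGeometry.EtaleTheta.ThetaFrobenioid
import Literature.AnabelianGeometry.EtaleTheta.RealifiedDivisorMonoidsOfRlf
import Literature.AnabelianGeometry.EtaleTheta.TemperedFrobenioidToy
import Literature.AnabelianGeometry.EtaleTheta.MonoprimeStructure
import Literature.AnabelianGeometry.EtaleTheta.PerfectionPrimes
import Literature.AnabelianGeometry.EtaleTheta.RealificationOrder
import Literature.AlgebraicGeometry.Frobenioids.RlfStructure
import Literature.AlgebraicGeometry.Frobenioids.MonoidTransport
import Literature.AlgebraicGeometry.Frobenioids.ArithmeticDivisorsPerfFactorial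

/-!
# [EtTh] Example 3.9 (i)–(iii): the data interface `Example39Data` is INHABITED over the tree's
# genuine [FrdI] vocabulary (non-vacuity witness)

S. Mochizuki, *The étale theta function and its Frobenioid-theoretic manifestations*, Publ. RIMS **45**
(2009) [MochizukiEtTh2009], Example 3.9 (i)–(iii), PDF pp. 83–84 (printed 309–310); with [FrdI]
[MochizukiFrdI2008] Def. 2.4 (i) p. 48 (the realification `M^rlf`, "`M^pf`, `M^rlf` are also
perf-factorial") and §0 p. 11 (perfections).

abc-iut cell, layer L2, ROW «NV-L2/Example39Data» (abc-iut-L2-lead gen 3, RULINGS #5 (R47); seat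
abc-iut-w5-d164 gen 3).  abc-iut-w5-d197's mechanised inhabitation census (INHABITATION-CENSUS-L2-v1)
lists abc-iut-L2-t3's DATA structure `Example39Data V DW TW` (`ThetaFrobenioid.lean`: the four base
categories `D_U, D_X, D_Y, D_W` with their functors and 1-commutativity, the cusp-unramified full
subcategories `D_Y^ell ⊆ D_Y`, `D_W^ell ⊆ D_W` WITH THEIR LEFT ADJOINTS, and the subfunctor in monoids
`Φ_W^ell ⊆ Φ_W^ℝ` with its four printed properties "perfect, group-saturated, perf-factorial,
non-dilating") among the structures with ZERO producers.  THIS FILE (proof-only: theorems only, no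
`def`, no `Prop` fact) proves `Nonempty (Example39Data …)` at

* the GENUINE monoid vocabulary `treeMonoidVocab` (`FrdIVocabulary.lean`: perf-factorial =
  `Frobenioids.IsPerfFactorial`, non-dilating = `Frobenioids.IsNonDilating` — the tree's real [FrdI]
  predicates, not the all-`True` `Toy.monoidVocab`), and
* the CONSTRUCTED realified data `RealifiedDivisorMonoids.ofRlfZ Toy.divisorMonoids _` (abc-iut-L6-t12's
  Def. 3.6 (i) constructor over abc-iut-L2-t3's Def. 3.3 (iii) toy data `Φ₀ = ℕ`, `B₀ = ℤ` on the one-object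
  base category; `Φ₀^ℝ = ℕ^rlf` is the REAL realification functor `rlfFunctor` of abc-iut-L2-d2),

with `Φ_W^ell :=` the image of the perfection `Φ₀^pf → Φ₀^rlf` — print's "`Φ_W` … given by forming the
perfection of the monoid `Φ₀`" (Ex. 3.9 (iii), p. 84), i.e. the legal degenerate case `Φ_W^ell := Φ_W`
("every divisor is theta-relevant") — whose four printed properties are then THEOREMS over the tree:
perfect (`≃ Φ₀^pf` by the injectivity of the factorization homomorphism), group-saturated in `Φ₀^rlf`
(abc-iut-L2-d2's order embedding `RlfCoord.toRealification_dvd_iff` — proved here for EVERY perf-factorial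
`Φ₀(A)`), perf-factorial (`≃ ℕ^pf`, monoprime, `MonoprimeStructure.isPerfFactorial`), and non-dilating
under pull-back by the endomorphisms of the base (identities on the one-object base).  The categorical
fields are the identity functors on the one-object category and Mathlib's `ObjectProperty.topEquivalence`
(`D^ell := D`, left adjoint `= lift ⊤ 𝟭`, a genuine adjunction).

HONEST LABEL: GENUINE vocabulary / realification / adjunctions / [FrdI] predicates; DEGENERATE geometry —
one object, `U = X = Y = W` (Galois group trivial, allowed by "order `≤ 2`"), `D^ell =` all coverings,
`Φ_W^ell = Φ_W`.  A consistency witness for the typed (i)–(iii) bundle; NOT the tempered Frobenioid of a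
curve; nothing here bears on [IUTchIII] Cor. 3.12.  Typed ≠ proved; a witness is consistency evidence only.
-/

noncomputable section

namespace Literature.AnabelianGeometry.EtaleTheta

open CategoryTheory Opposite Literature.AlgebraicGeometry.Frobenioids

universe w

/-! ### The image of `M^pf` in `M^rlf` (print's `Φ_W ⊆ Φ_W^ℝ`): perfect, group-saturated, and — for
monoprime `M` — perf-factorial -/

namespace Example39NV

variable {M : Type w} [CommMonoid M]

/-- `M^pf → M^rlf` is injective for a perf-factorial `M` (the factorization homomorphism is injective,
[FrdI] Def. 2.4 (i)(c)). [cite: MochizukiFrdI2008, Def. 2.4(i) p.47] -/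
theorem toRealification_injective (hM : IsPerfFactorial M) : Function.Injective hM.toRealification :=
  fun _ _ h => hM.factorMap_injective (congrArg Subtype.val h)

/-- `M^pf ≅` its image in `M^rlf` (bijectivity of the range restriction). [cite: MochizukiFrdI2008, Def. 2.4(i) p.48] -/
theorem mrangeRestrict_toRealification_bijective (hM : IsPerfFactorial M) :
    Function.Bijective hM.toRealification.mrangeRestrict :=
  ⟨fun _ _ h => toRealification_injective hM (congrArg Subtype.val h),
    MonoidHom.mrangeRestrict_surjective _⟩

/-- **The image of `M^pf` in `M^rlf` is perfect** ("`M^pf` is perfect", [FrdI] §0 p. 11, transported along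
`M^pf ≅ im`). [cite: MochizukiFrdI2008, §0 p.11] -/
theorem isPerfect_mrange_toRealification (hM : IsPerfFactorial M) :
    IsPerfect (MonoidHom.mrange hM.toRealification) :=
  IsPerfect.of_mulEquiv (MulEquiv.ofBijective _ (mrangeRestrict_toRealification_bijective hM))
    isPerfect_perfection

/-- **The image of `M^pf` in `M^rlf` is group-saturated** ([EtTh] §0 p. 8) for every perf-factorial `M`:
if `q · b = a` in `M^rlf` with `a, b ∈ M^pf`, then `b ≤ a` in `M^rlf`, hence in `M^pf` (the order embedding
`M^pf ↪ M^rlf`, [EtTh] Lemma 3.5 p. 76 / abc-iut-L2-d2 `RlfCoord.toRealification_dvd_iff`), so `q = a/b ∈ M^pf`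
by cancellation in `M^rlf`. [cite: MochizukiEtTh2009, Lem 3.5 p.76] -/
theorem isGroupSaturated_mrange_toRealification (hM : IsPerfFactorial M) :
    IsGroupSaturated (MonoidHom.mrange hM.toRealification) := by
  rw [isGroupSaturated_iff']
  rintro q _ ⟨a, rfl⟩ _ ⟨b, rfl⟩ h
  have hdvd : hM.toRealification b ∣ hM.toRealification a := ⟨q, by rw [mul_comm, h]⟩
  obtain ⟨c, hc⟩ :=
    (RlfCoord.toRealification_dvd_iff hM (PerfectionPrimes.isMonoprime_pfAt hM) b a).mp hdvd
  haveI := IsPerfFactorial.Rlf.isCancelMul hM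
  refine ⟨c, ?_⟩
  have h' : q * hM.toRealification b = hM.toRealification c * hM.toRealification b := by
    rw [h, hc, map_mul, mul_comm]
  exact (mul_right_cancel h').symm

/-- For a MONOPRIME `M` (e.g. `ℕ`), the image of `M^pf` in `M^rlf` is monoprime (`≅ M^pf`, and the
perfection of a monoprime monoid is monoprime). [cite: MochizukiFrdI2008, §0 p.11] -/
theorem isMonoprime_mrange_toRealification (hM : IsMonoprime M) :
    IsMonoprime (MonoidHom.mrange (MonoprimeStructure.isPerfFactorial hM).toRealification) :=
  IsMonoprime.of_mulEquiv
    (MulEquiv.ofBijective _ (mrangeRestrict_toRealification_bijective (MonoprimeStructure.isPerfFactorial hM)))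
    (PerfectionPrimes.isMonoprime_perfection hM)

/-- **For a monoprime `M`, the image of `M^pf` in `M^rlf` is perf-factorial** ("`M^pf` … [is] also
perf-factorial", [FrdI] Def. 2.4 (i) p. 48, in the monoprime case: a monoprime monoid is perf-factorial,
`MonoprimeStructure.isPerfFactorial`). [cite: MochizukiFrdI2008, Def. 2.4(i) p.48] -/
theorem isPerfFactorial_mrange_toRealification (hM : IsMonoprime M) :
    IsPerfFactorial (MonoidHom.mrange (MonoprimeStructure.isPerfFactorial hM).toRealification) :=
  MonoprimeStructure.isPerfFactorial (isMonoprime_mrange_toRealification hM)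

/-- The identity endomorphism of any monoid is non-dilating ([FrdI] Def. 1.1 (i): the conclusion
`α^char = id` holds outright). [cite: MochizukiFrdI2008, Def. 1.1(i) p.19] -/
theorem isNonDilating_id : IsNonDilating (MonoidHom.id M) := by
  intro _
  ext x
  obtain ⟨a, rfl⟩ := Associates.mk_surjective x
  rfl

end Example39NV

/-! ### The toy Def. 3.3 (iii) data: `Φ₀ = ℕ` is perf-factorial in the tree's sense -/

namespace Toy

/-- `Φ₀(Y) = ℕ` of the toy Def. 3.3 (iii) data is perf-factorial in the TREE's (abc-iut-L1) sense
(`ℕ` is monoprime; monoprime ⇒ perf-factorial). [cite: MochizukiEtTh2009, Prop 3.4 p.74] -/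
theorem isPerfFactorial_Φ₀ (Y : (Discrete PUnit.{1})ᵒᵖ) : IsPerfFactorial (divisorMonoids.Φ₀.obj Y) :=
  MonoprimeStructure.isPerfFactorial isMonoprime_multiplicative_nat

/-- The same, read on the carrier `Multiplicative ℕ` (`Φ₀` is the constant functor). [cite: MochizukiEtTh2009, Prop 3.4 p.74] -/
theorem isPerfFactorial_nat : IsPerfFactorial (Multiplicative ℕ) :=
  MonoprimeStructure.isPerfFactorial isMonoprime_multiplicative_nat

end Toy

/-! ### The witness -/

namespace Example39Data

open Example39NV

/-- **[EtTh] Example 3.9 (i)–(iii): `Example39Data` is inhabited** over the GENUINE vocabulary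
`treeMonoidVocab` and the CONSTRUCTED realified data `ofRlfZ Toy.divisorMonoids _` (`Φ₀ = ℕ`,
`Φ₀^ℝ = ℕ^rlf` the real realification): `D_U = D_X = D_Y = D_W :=` the one-object base, all four functors
identities (1-commutativity `= Iso.refl`), `D^ell := D` with left adjoint `lift ⊤ 𝟭 ⊣ ι` (Mathlib
`ObjectProperty.topEquivalence`), `Φ_W^ell := im(Φ₀^pf → Φ₀^rlf) = Φ_W` — perfect, group-saturated,
perf-factorial, non-dilating as THEOREMS (`Example39NV.*`).  Degenerate geometry (one object, trivial Galois
group, every covering "cusp-unramified", every divisor "theta-relevant"); genuine predicates.  A consistency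
witness only. [cite: MochizukiEtTh2009, Ex 3.9 p.83] -/
theorem nonempty_treeMonoidVocab_ofRlfZ_toy :
    Nonempty (Example39Data treeMonoidVocab.{0} (Discrete PUnit.{1})
      (RealifiedDivisorMonoids.ofRlfZ Toy.divisorMonoids Toy.isPerfFactorial_Φ₀)) := by
  refine ⟨{
    DU := Discrete PUnit.{1}
    DX := Discrete PUnit.{1}
    DY := Discrete PUnit.{1}
    fUX := 𝟭 _
    fUY := 𝟭 _
    fXW := 𝟭 _
    fYW := 𝟭 _
    oneComm := Iso.refl _
    ellY := ⊤
    ellW := ⊤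
    toEllY := (ObjectProperty.topEquivalence (Discrete PUnit.{1})).inverse
    adjY := (ObjectProperty.topEquivalence (Discrete PUnit.{1})).symm.toAdjunction
    toEllW := (ObjectProperty.topEquivalence (Discrete PUnit.{1})).inverse
    adjW := (ObjectProperty.topEquivalence (Discrete PUnit.{1})).symm.toAdjunction
    ΦellW :=
      { carrier := fun A => MonoidHom.mrange (Toy.isPerfFactorial_Φ₀ A).toRealification
        map_mem := ?_ }
    isPerfect := fun A => isPerfect_mrange_toRealification (Toy.isPerfFactorial_Φ₀ A)
    isGroupSaturated := fun A => isGroupSaturated_mrange_toRealification (Toy.isPerfFactorial_Φ₀ A)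
    isPerfFactorial := fun A => isPerfFactorial_mrange_toRealification isMonoprime_multiplicative_nat
    isNonDilating := ?_ }⟩
  · -- stability of `im(Φ₀^pf → Φ₀^rlf)` under pull-back: `Φ₀(f)^rlf ∘ ι = ι ∘ Φ₀(f)^pf`
    rintro A B f _ ⟨a, rfl⟩
    refine ⟨Perfection.map (Toy.divisorMonoids.Φ₀.map f).hom a, ?_⟩
    have h := DFunLike.congr_fun
      (rlfMap_comp_toRealification Toy.divisorMonoids.Φ₀ Toy.isPerfFactorial_Φ₀ f) a
    simp only [MonoidHom.comp_apply] at h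
    exact h.symm
  · -- endomorphisms of the one-object base are identities, so every pull-back is the identity
    intro A f
    have hf : f = 𝟙 A := Quiver.Hom.unop_inj (Subsingleton.elim _ _)
    subst hf
    rw [treeMonoidVocab_isNonDilating]
    have key : ∀ S : SubMonoidOn
        (RealifiedDivisorMonoids.ofRlfZ Toy.divisorMonoids Toy.isPerfFactorial_Φ₀).ΦR,
        IsNonDilating (S.pull (𝟙 A)) := by
      intro S
      have hpull : S.pull (𝟙 A) = MonoidHom.id _ := by
        ext x
        rw [SubMonoidOn.coe_pull, CategoryTheory.Functor.map_id, MonoidHom.id_apply]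
        rfl
      rw [hpull]
      exact isNonDilating_id
    exact key _

end Example39Data

end Literature.AnabelianGeometry.EtaleTheta

end
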